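import Literature.Topology.FourManifolds.Gluing
import Mathlib.Topology.Homotopy.Basic
import HarnessLib

/-!
# Pushing maps off the boundary along a collar

Topic `Literature/Topology/FourManifolds` (infrastructure for the fact seat of
`Literature.Topology.FourManifolds.HomotopySphere.exists_highlyConnected_of_mem_signatureSet`,
brick B8-E₁: the first step of representing a homotopy class by an embedded sphere in the
INTERIOR of a manifold with boundary).  A collar `κ : bM × [0, 1] ↪ M` of the boundary gives a
homotopy of the identity of `M` to a map with values in the interior `M ∖ bM`: slide the collar
coordinate by `t ↦ 1 - (1 - t)(1 - s/2)` (the identity near the inner end `t = 1`, where the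
formula is pasted with the identity of the complement).  Consequently every continuous map into
`M` is homotopic to one with values in the interior (Hirsch, *Differential Topology* (1976),
§4.6; Kosinski, *Differential Manifolds* (1993), X §2, proof of (2.2): surgery "inside `W`").

* `BoundaryData.Collar.exists_homotopic_id_forall_mem_interior` — `∃ P : C(M, M)` homotopic to
  the identity with `P w ∈ Int M` for all `w`;
* `BoundaryData.Collar.exists_homotopic_forall_mem_interior` — every `f : C(Y, M)` is homotopic
  to some `g` with `g y ∈ Int M` for all `y`.

Everything is proved; no definitions, no named facts.

## References

* M. W. Hirsch, *Differential Topology* (1976), §4.6 (collars). [HirschDT1976]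
* A. Kosinski, *Differential Manifolds* (1993), Ch. X §2, Thm. (2.2) (proof). [Kosinski1993]
-/

open scoped Topology
open Set Function Topology

noncomputable section

namespace Literature.Topology.FourManifolds

namespace BoundaryData.Collar

universe u

variable {E H E₀ H₀ : Type*} [NormedAddCommGroup E] [NormedSpace ℝ E] [TopologicalSpace H]
  [NormedAddCommGroup E₀] [NormedSpace ℝ E₀] [TopologicalSpace H₀]
  {I : ModelWithCorners ℝ E H} {M : Type u} [TopologicalSpace M] [ChartedSpace H M]
  {I₀ : ModelWithCorners ℝ E₀ H₀} {b : BoundaryData I M I₀}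

/-- Points of `M` off the open collar `κ(bM × [0, 1))` are interior points. [folklore] -/
theorem mem_interior_of_not_mem_image (κ : b.Collar) {w : M}
    (hw : w ∉ κ '' {p | (p.2 : ℝ) < 1}) : w ∈ I.interior M := by
  rw [← ModelWithCorners.compl_boundary, mem_compl_iff, ← b.range_incl]
  rintro ⟨x, rfl⟩
  exact hw ⟨(x, ⊥), by show ((⊥ : Set.Icc (0 : ℝ) 1) : ℝ) < 1; exact zero_lt_one, κ.apply_bot x⟩

/-- **Pushing `M` into its interior along a collar**: for a collar `κ` of a compact boundary
(in a Hausdorff `M`) there is a continuous `P : M → M`, homotopic to the identity, with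
`P w ∈ Int M` for every `w` (slide the collar coordinate `t ↦ 1 - (1 - t)/2`, paste with the
identity off the collar).  Hirsch (1976), §4.6. [cite: HirschDT1976, §4.6] -/
theorem exists_homotopic_id_forall_mem_interior [T2Space M] [CompactSpace b.carrier]
    (κ : b.Collar) :
    ∃ P : C(M, M), (ContinuousMap.id M).Homotopic P ∧ ∀ w, P w ∈ I.interior M := by
  classical
  rcases isEmpty_or_nonempty b.carrier with hE | hne
  · -- no boundary: the identity will do
    refine ⟨ContinuousMap.id M, ContinuousMap.Homotopic.refl _, fun w => ?_⟩
    refine κ.mem_interior_of_not_mem_image ?_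
    rintro ⟨p, -, -⟩
    exact hE.elim p.1
  -- the inverse of the collar on its (closed) range
  have hκ : IsEmbedding κ := κ.isSmoothEmbedding.isEmbedding
  set kinv : M → b.carrier × Set.Icc (0 : ℝ) 1 := Function.invFun κ with hkinv
  have hkinv_apply : ∀ p, kinv (κ p) = p := fun p =>
    κ.injective (Function.invFun_eq ⟨p, rfl⟩)
  have hκkinv : ∀ w ∈ range κ, κ (kinv w) = w := fun w hw => Function.invFun_eq hw
  have hkinv_cont : ContinuousOn kinv (range κ) := by
    rw [continuousOn_iff_continuous_restrict]
    have heq : (range κ).restrict kinv = hκ.toHomeomorph.symm := by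
      funext w
      obtain ⟨p, hp⟩ := w.2
      have hw : w = ⟨κ p, ⟨p, rfl⟩⟩ := Subtype.ext hp.symm
      rw [hw, hκ.toHomeomorph_symm_apply]
      exact hkinv_apply p
    rw [heq]
    exact hκ.toHomeomorph.symm.continuous
  have hclosed : IsClosed (range κ) := (isCompact_range κ.continuous).isClosed
  -- the slide of the collar coordinate
  set φ : unitInterval × Set.Icc (0 : ℝ) 1 → Set.Icc (0 : ℝ) 1 := fun q =>
    ⟨1 - (1 - (q.2 : ℝ)) * (1 - (q.1 : ℝ) / 2), by
      obtain ⟨hs0, hs1⟩ := q.1.2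
      obtain ⟨ht0, ht1⟩ := q.2.2
      constructor <;> nlinarith⟩ with hφ
  have hφc : Continuous φ := by
    refine Continuous.subtype_mk ?_ _
    fun_prop
  have hφ0 : ∀ t, φ (0, t) = t := fun t => Subtype.ext (by simp [hφ])
  have hφ1 : ∀ s, φ (s, ⊤) = ⊤ := fun s => Subtype.ext (by
    simp [hφ, show ((⊤ : Set.Icc (0 : ℝ) 1) : ℝ) = 1 from rfl])
  have hφpos : ∀ (s : unitInterval) (t : Set.Icc (0 : ℝ) 1), 0 < (s : ℝ) → ⊥ < φ (s, t) := by
    intro s t hs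
    rw [← Subtype.coe_lt_coe]
    show (0 : ℝ) < 1 - (1 - (t : ℝ)) * (1 - (s : ℝ) / 2)
    obtain ⟨hs0, hs1⟩ := s.2
    obtain ⟨ht0, ht1⟩ := t.2
    nlinarith
  -- the homotopy, pasted from the slide on the collar and the identity off it
  set F : M × unitInterval → M := fun q =>
    if q.1 ∈ range κ then κ ((kinv q.1).1, φ (q.2, (kinv q.1).2)) else q.1 with hF
  have hFcont : Continuous F := by
    refine continuous_if ?_ ?_ continuousOn_fst
    · -- agreement on the frontier: there the collar coordinate is `1`
      rintro ⟨w, s⟩ hws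
      have hcl : IsClosed {q : M × unitInterval | q.1 ∈ range κ} := hclosed.preimage continuous_fst
      have hw1 : w ∈ range κ := by
        have : (w, s) ∈ closure {q : M × unitInterval | q.1 ∈ range κ} := frontier_subset_closure hws
        rw [hcl.closure_eq] at this
        exact this
      have hw2 : w ∉ κ '' {p | (p.2 : ℝ) < 1} := by
        intro hw
        have hO : IsOpen {q : M × unitInterval | q.1 ∈ κ '' {p | (p.2 : ℝ) < 1}} :=
          κ.isOpen_image.preimage continuous_fst
        have hsub : {q : M × unitInterval | q.1 ∈ κ '' {p | (p.2 : ℝ) < 1}} ⊆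
            {q : M × unitInterval | q.1 ∈ range κ} :=
          fun q hq => image_subset_range _ _ hq
        have hint : (w, s) ∈ interior {q : M × unitInterval | q.1 ∈ range κ} :=
          interior_mono hsub (hO.interior_eq.symm ▸ hw)
        exact hws.2 hint
      obtain ⟨⟨x, t⟩, rfl⟩ := hw1
      have hp1 : t = ⊤ := by
        by_contra hne
        refine hw2 ⟨(x, t), ?_, rfl⟩
        show (t : ℝ) < 1
        exact lt_of_le_of_ne t.2.2 fun h1 => hne (Subtype.ext h1)
      subst hp1
      show κ ((kinv (κ (x, ⊤))).1, φ (s, (kinv (κ (x, ⊤))).2)) = κ (x, ⊤)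
      rw [hkinv_apply, hφ1]
    · have hcl : IsClosed {q : M × unitInterval | q.1 ∈ range κ} := hclosed.preimage continuous_fst
      rw [hcl.closure_eq]
      refine κ.continuous.comp_continuousOn (ContinuousOn.prodMk ?_ ?_)
      · exact (continuous_fst.comp_continuousOn
          (hkinv_cont.comp continuousOn_fst fun q hq => hq))
      · refine hφc.comp_continuousOn (ContinuousOn.prodMk continuousOn_snd ?_)
        exact continuous_snd.comp_continuousOn
          (hkinv_cont.comp continuousOn_fst fun q hq => hq)
  have hF0 : ∀ w, F (w, 0) = w := fun w => by
    simp only [hF]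
    split_ifs with h
    · rw [hφ0]; exact hκkinv w h
    · rfl
  set P : C(M, M) := ⟨fun w => F (w, 1), hFcont.comp (by fun_prop)⟩ with hP
  let Hty : (ContinuousMap.id M).Homotopy P :=
    { toFun := fun q => F (q.2, q.1),
      continuous_toFun := hFcont.comp (by fun_prop),
      map_zero_left := fun w => hF0 w,
      map_one_left := fun w => rfl }
  refine ⟨P, ⟨Hty⟩, fun w => ?_⟩
  show F (w, 1) ∈ I.interior M
  simp only [hF]
  split_ifs with h
  · exact κ.apply_mem_interior _ (hφpos 1 _ (by norm_num))
  · exact κ.mem_interior_of_not_mem_image fun hw => h (image_subset_range _ _ hw)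

/-- **Every map into a collared manifold is homotopic to a map into the interior.**
[cite: HirschDT1976, §4.6] -/
theorem exists_homotopic_forall_mem_interior [T2Space M] [CompactSpace b.carrier]
    (κ : b.Collar) {Y : Type*} [TopologicalSpace Y] (f : C(Y, M)) :
    ∃ g : C(Y, M), f.Homotopic g ∧ ∀ y, g y ∈ I.interior M := by
  obtain ⟨P, hP, hPint⟩ := κ.exists_homotopic_id_forall_mem_interior
  refine ⟨P.comp f, ?_, fun y => hPint (f y)⟩
  have h := hP.comp (ContinuousMap.Homotopic.refl f)
  simpa using h

end BoundaryData.Collar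

end Literature.Topology.FourManifolds
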